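import Summits.CriticalPhenomena.PercolationContinuityZ3.Theorems.PercNearOneGluingNoHeavyLowerTailSahiCombOrderTwoC3

/-!
# Sahi's `C_3` on product measures from the ENDPOINT inequality `2Φ(0) + Φ′(0) ≥ 0` of the log-derivative schema
# (measure level), and from the BOTTOM half `c_0 ≤ c_1` of comb ORDER-1(3)

Support file of the one-cut programme (crux `NoHeavyLowerTail`, stmt-CriticalPhenomena-4575; cell `prim-bnk`, seat bnk-2 gen 8,
memo `run/shared/lean/prim/prim-l12/FROM-prim-bnk-2-g8-TWO-LEVEL-C3.md`; INEQ-CLAIMS rows COMB-M-E3, S2-GRAPH).  Companion: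
`…SahiTwoLevelC3` (the explicit two-level form "C₃-M⁻" of prim-ineq-gen-4 g5 §II and the named conjectures).

Along one coordinate `e` of a product measure `μ_p` the function `x ↦ Φ(x) = E_3(μ_{p[e ↦ x]}; 1_{U_0},1_{U_1},1_{U_2})` is the cubic
`cubicE3` (`…SahiMasterFamilyCommonPivotal`), with `Φ(0) = E_3` of the `0`-sections.  The M⁻-schema of prim-ineq-gen-4 g5
(`…LogDerivSchema`: `2Φ + (1−x)Φ′ ≥ 0` on `[0,1)` and `Φ(0) ≥ 0` give `Φ ≥ 0`) needs the differential inequality at EVERY `x`; the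
point of this file is that the ENDPOINT inequality at `x = 0` for all triples on all cubes already gives it, by the PARALLEL
substitution (`parBlock`: the coordinate `e` of `Fin r` becomes `{some e} ∨ {none}` on `Option (Fin r)`; `SahiCombSubstitution.sahiE_subst`
reparametrises `p_e = x + (1−x)y`, and `2Ψ(0) + Ψ′(0) = 2Φ(x) + (1−x)Φ′(x)` for `Ψ(y) = Φ(x + (1−x)y)`, in four-point form).
* `SahiLogDerivEnd.masterFamilyNonneg_three_of_logDerivEnd_nonneg` — `2Φ(0) + Φ′(0) ≥ 0` along every axis (with a second point) of every
  triple of increasing events on every finite cube ⟹ `MasterFamilyNonneg 3` (Kahn's Conjecture 5); induction on a determining set.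
* `SahiLogDerivEnd.lineSum_one_sub_zero_eq` — `B_1 − B_0 = 2Φ(0) + Φ′(0)` for the line sums of the comb expansion
  (`SahiCombTopC3.lineSum`, gen 7); hence **`masterFamilyNonneg_three_of_combLine_bottom_le`**, **`kahnConjecture_of_combLine_bottom_le`**:
  the BOTTOM half `c_0 ≤ c_1` of comb ORDER-1(3) on every coefficient line alone implies `C_3` — companion of gen 7's top half
  `masterFamilyNonneg_three_of_combLine_top_le`; either half suffices (census: both halves hold for `E_3` on `m ≤ 5` coordinates
  EXHAUSTIVELY, ttrl topform RESULT 5, `5.7·10¹⁰` line checks per direction, `0` violations).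
Everything here is proved; axioms standard; `C_3` itself remains OPEN. [this work]
-/

noncomputable section

open scoped Classical

namespace Summit.CriticalPhenomena.PercolationContinuityZ3.Theorems

open Finset Function
open Literature.Combinatorics.Sahi2008
open Literature.Probability.LatticeModels (prodBernoulli prodBernoulli_real_setOf_notMem
  prodBernoulli_real_inter_of_determinedBy_disjoint)
open Literature.Probability.Percolation (DeterminedBy determinedBy_iff)
open Literature.Probability.Percolation.DecisionTree (ind ind_of_mem ind_of_not_mem ind_nonneg)
open SahiComb SahiCombSubstitution

namespace SahiLogDerivEnd

/-! ### The fibre cubic: monomial form and the endpoint quantity `2Φ(0) + Φ′(0)` -/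

section Cubic

variable {κ : Type*} [Fintype κ]

/-- **`∂E_3/∂q_a` at `q_a = 0`**: the linear coefficient of the fibre cubic `cubicE3 q a f g h`, explicit in the section moments
`X_b = secEx q a · b` (`Δ = X₁ − X₀`): `2Δ(fgh) + Σ_cyc Δ(f)X₀(g)X₀(h) − Σ_cyc [Δ(f)X₀(gh) + X₀(f)Δ(gh)]`. [this work] -/
def derivE3AtZero (q : κ → unitInterval) (a : κ) (f g h : Set κ → ℝ) : ℝ :=
  2 * (secEx q a (f * g * h) true - secEx q a (f * g * h) false)
    + ((secEx q a f true - secEx q a f false) * secEx q a g false * secEx q a h false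
        + secEx q a f false * (secEx q a g true - secEx q a g false) * secEx q a h false
        + secEx q a f false * secEx q a g false * (secEx q a h true - secEx q a h false))
    - ((secEx q a f true - secEx q a f false) * secEx q a (g * h) false
        + secEx q a f false * (secEx q a (g * h) true - secEx q a (g * h) false)
        + (secEx q a g true - secEx q a g false) * secEx q a (f * h) false
        + secEx q a g false * (secEx q a (f * h) true - secEx q a (f * h) false)
        + (secEx q a h true - secEx q a h false) * secEx q a (f * g) false
        + secEx q a h false * (secEx q a (f * g) true - secEx q a (f * g) false))

/-- **The fibre cubic in the monomial basis**: `Φ(x) = Φ(0) + derivE3AtZero·x + c₂x² + c₃x³` for some `c₂, c₃`. [this work] -/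
theorem cubicE3_eq_cubic (q : κ → unitInterval) (a : κ) (f g h : Set κ → ℝ) :
    ∃ c₂ c₃ : ℝ, ∀ x : ℝ, cubicE3 q a f g h x =
      cubicE3 q a f g h 0 + derivE3AtZero q a f g h * x + c₂ * x ^ 2 + c₃ * x ^ 3 := by
  refine ⟨((secEx q a f true - secEx q a f false) * (secEx q a g true - secEx q a g false) * secEx q a h false
      + (secEx q a f true - secEx q a f false) * secEx q a g false * (secEx q a h true - secEx q a h false)
      + secEx q a f false * (secEx q a g true - secEx q a g false) * (secEx q a h true - secEx q a h false))
      - ((secEx q a f true - secEx q a f false) * (secEx q a (g * h) true - secEx q a (g * h) false)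
        + (secEx q a g true - secEx q a g false) * (secEx q a (f * h) true - secEx q a (f * h) false)
        + (secEx q a h true - secEx q a h false) * (secEx q a (f * g) true - secEx q a (f * g) false)),
    (secEx q a f true - secEx q a f false) * (secEx q a g true - secEx q a g false)
      * (secEx q a h true - secEx q a h false), fun x => ?_⟩
  simp only [cubicE3, derivE3AtZero]
  ring

/-- **Four-point form of the endpoint quantity**: for the fibre cubic,
`2Φ(0) + Φ′(0) = −(7/2)Φ(0) + 9Φ(⅓) − (9/2)Φ(⅔) + Φ(1)`. [folklore] -/
theorem logDerivEnd_eq_fourPoint (q : κ → unitInterval) (a : κ) (f g h : Set κ → ℝ) :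
    2 * cubicE3 q a f g h 0 + derivE3AtZero q a f g h =
      -(7 / 2) * cubicE3 q a f g h 0 + 9 * cubicE3 q a f g h (1 / 3) - (9 / 2) * cubicE3 q a f g h (2 / 3)
        + cubicE3 q a f g h 1 := by
  obtain ⟨c₂, c₃, hc⟩ := cubicE3_eq_cubic q a f g h
  rw [hc (1 / 3), hc (2 / 3), hc 1]
  ring

/-- **Reparametrised four-point form** (`LogDerivSchema.logDeriv_reparam` for the cubic): with `y ↦ x + (1−x)y`,
`−(7/2)Φ(x) + 9Φ(x + (1−x)/3) − (9/2)Φ(x + 2(1−x)/3) + Φ(1) = 2Φ(x) + (1−x)Φ′(x)`. [folklore] -/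
theorem fourPoint_reparam (q : κ → unitInterval) (a : κ) (f g h : Set κ → ℝ) (x : ℝ) :
    -(7 / 2) * cubicE3 q a f g h x + 9 * cubicE3 q a f g h (x + (1 - x) * (1 / 3))
        - (9 / 2) * cubicE3 q a f g h (x + (1 - x) * (2 / 3)) + cubicE3 q a f g h (x + (1 - x) * 1) =
      2 * cubicE3 q a f g h x + (1 - x) * deriv (cubicE3 q a f g h) x := by
  obtain ⟨c₂, c₃, hc⟩ := cubicE3_eq_cubic q a f g h
  have hfun : cubicE3 q a f g h = fun x =>
      cubicE3 q a f g h 0 + derivE3AtZero q a f g h * x + c₂ * x ^ 2 + c₃ * x ^ 3 := funext hc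
  rw [hfun, (LogDerivSchema.cubic_hasDerivAt _ _ c₂ c₃ x).deriv]
  ring

/-- The fibre cubic is differentiable. [folklore] -/
theorem differentiable_cubicE3 (q : κ → unitInterval) (a : κ) (f g h : Set κ → ℝ) :
    Differentiable ℝ (cubicE3 q a f g h) := by
  obtain ⟨c₂, c₃, hc⟩ := cubicE3_eq_cubic q a f g h
  have hfun : cubicE3 q a f g h = fun x =>
      cubicE3 q a f g h 0 + derivE3AtZero q a f g h * x + c₂ * x ^ 2 + c₃ * x ^ 3 := funext hc
  rw [hfun]
  exact fun x => (LogDerivSchema.cubic_hasDerivAt _ _ c₂ c₃ x).differentiableAt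

/-- `E_3(μ_{q[a ↦ s]}; 1_U)` is the fibre cubic at `s` (the tree's `sahiE_three_update_eq`, for a `Fin 3`-indexed family). [this work] -/
theorem sahiE_three_ind_update_eq (q : κ → unitInterval) (a : κ) (s : unitInterval) (U : Fin 3 → Set (Set κ)) :
    sahiE (bernoulliWeight (update q a s)) 3 (fun j => ind (U j)) =
      cubicE3 q a (ind (U 0)) (ind (U 1)) (ind (U 2)) (s : ℝ) := by
  have hU : (fun j => ind (U j)) = ![ind (U 0), ind (U 1), ind (U 2)] := by
    funext j
    fin_cases j <;> rfl
  rw [hU, sahiE_three_update_eq]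

/-- The fibre cubic at `0` is `E_3` of the `0`-sections under the original measure. [this work] -/
theorem cubicE3_zero_eq_secAt (q : κ → unitInterval) (a : κ) (U : Fin 3 → Set (Set κ)) :
    cubicE3 q a (ind (U 0)) (ind (U 1)) (ind (U 2)) 0 =
      sahiE (bernoulliWeight q) 3 (fun j => ind (secAt a false (U j))) := by
  have h0 : ((boolParam false : unitInterval) : ℝ) = 0 := by simp [boolParam]
  rw [← h0, ← sahiE_three_ind_update_eq, sahiE_three_update_boolParam,
    sahiE_three_secAt_update q a false (boolParam false) (q a), update_eq_self]

end Cubic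

/-! ### The parallel substitution: one coordinate replaced by two coordinates in parallel -/

section Parallel

attribute [local instance 1001] Classical.propDecidable

variable {r : ℕ}

/-- **The parallel blocks** on the cube `Option (Fin r)`: `X_j = {some j ∈ ω}` for `j ≠ e` and `X_e = {some e ∈ ω ∨ none ∈ ω}`
(the coordinate `e` is open iff `some e` OR the new point `none` is open — a parallel edge). [this work] -/
def parBlock (e j : Fin r) : Set (Set (Option (Fin r))) :=
  if j = e then {ω | some e ∈ ω ∨ none ∈ ω} else {ω | some j ∈ ω}

/-- The parallel blocks are increasing events. [this work] -/
theorem isUpperSet_parBlock (e j : Fin r) : IsUpperSet (parBlock e j) := by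
  unfold parBlock
  split_ifs
  · exact fun _ _ hle h => h.elim (fun h1 => Or.inl (hle h1)) fun h2 => Or.inr (hle h2)
  · exact fun _ _ hle h => hle h

/-- Each parallel block is determined by the corresponding series support `{some e, none}` resp. `{some j}`
(`SahiCombTopC3.serSupp`). [this work] -/
theorem determinedBy_parBlock (e j : Fin r) :
    DeterminedBy (parBlock e j) (↑(SahiCombTopC3.serSupp e j) : Set (Option (Fin r))) := by
  unfold parBlock SahiCombTopC3.serSupp
  split_ifs with hj
  · rw [determinedBy_iff]
    intro ω ω' h
    have h1 := Set.ext_iff.1 h (some e)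
    have h2 := Set.ext_iff.1 h none
    simp only [Set.mem_inter_iff, Finset.coe_insert, Finset.coe_singleton, Set.mem_insert_iff,
      Set.mem_singleton_iff, true_or, or_true, and_true] at h1 h2
    simp only [Set.mem_setOf_eq, h1, h2]
  · exact SahiCombTopC3.determinedBy_mem_singleton (some j)

/-- **The block parameters of the parallel blocks**: `μ_{p'}(X_j) = p_j` (`j ≠ e`) and `μ_{p'}(X_e) = 1 − (1−s)(1−y)` — the law of the
bit vector is the product measure with `p_e` replaced by `s + (1−s)y` (`SahiCombTopC3.serBase`: `p` off `e`, `s` at `some e`). [this work] -/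
theorem blockParam_parBase (p : Fin r → unitInterval) (e : Fin r) (σ y : unitInterval) :
    blockParam (update (SahiCombTopC3.serBase p e σ) none y) (parBlock e) =
      update p e (unitInterval.symm (unitInterval.symm σ * unitInterval.symm y)) := by
  funext j
  apply Subtype.ext
  simp only [blockParam]
  rw [ex_bernoulliWeight_ind]
  by_cases hj : j = e
  · subst hj
    rw [update_self, unitInterval.coe_symm_eq, Set.Icc.coe_mul, unitInterval.coe_symm_eq, unitInterval.coe_symm_eq]
    have hsplit : (parBlock j j)ᶜ = {ω : Set (Option (Fin r)) | some j ∉ ω} ∩ {ω | none ∉ ω} := by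
      ext ω
      unfold parBlock
      rw [if_pos rfl]
      simp only [Set.mem_compl_iff, Set.mem_setOf_eq, not_or, Set.mem_inter_iff]
    have hsb : SahiCombTopC3.serBase p j σ (some j) = σ := by simp [SahiCombTopC3.serBase]
    have hc : (prodBernoulli (update (SahiCombTopC3.serBase p j σ) none y)).real (parBlock j j) =
        1 - (prodBernoulli (update (SahiCombTopC3.serBase p j σ) none y)).real (parBlock j j)ᶜ := by
      rw [MeasureTheory.probReal_compl_eq_one_sub MeasurableSet.of_discrete]; ring
    have hd1 : DeterminedBy {ω : Set (Option (Fin r)) | some j ∉ ω} (↑({some j} : Finset (Option (Fin r))) : Set _) := by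
      rw [determinedBy_iff]
      intro ω ω' h
      have hx := Set.ext_iff.1 h (some j)
      simp only [Set.mem_inter_iff, Finset.coe_singleton, Set.mem_singleton_iff, and_true] at hx
      simp only [Set.mem_setOf_eq, hx]
    have hd2 : DeterminedBy {ω : Set (Option (Fin r)) | none ∉ ω} (↑({none} : Finset (Option (Fin r))) : Set _) := by
      rw [determinedBy_iff]
      intro ω ω' h
      have hx := Set.ext_iff.1 h none
      simp only [Set.mem_inter_iff, Finset.coe_singleton, Set.mem_singleton_iff, and_true] at hx
      simp only [Set.mem_setOf_eq, hx]
    rw [hc, hsplit, prodBernoulli_real_inter_of_determinedBy_disjoint _ (F := {some j}) (F' := {none})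
      (Finset.disjoint_singleton.2 (Option.some_ne_none j)) hd1 hd2 MeasurableSet.of_discrete MeasurableSet.of_discrete,
      prodBernoulli_real_setOf_notMem, prodBernoulli_real_setOf_notMem, update_of_ne (Option.some_ne_none j), update_self, hsb]
  · rw [update_of_ne hj]
    have hblk : parBlock e j = {ω : Set (Option (Fin r)) | some j ∈ ω} := by
      unfold parBlock; rw [if_neg hj]
    have hsb : SahiCombTopC3.serBase p e σ (some j) = p j := by simp [SahiCombTopC3.serBase, hj]
    rw [hblk, Literature.Probability.LatticeModels.prodBernoulli_real_setOf_mem, update_of_ne (Option.some_ne_none j), hsb]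

/-- **Parallel substitution leaves `E_3` unchanged up to the reparametrisation `p_e = 1 − (1−s)(1−y)`.** [this work] -/
theorem sahiE_parSubst (p : Fin r → unitInterval) (e : Fin r) (σ y : unitInterval) (U : Fin 3 → Set (Set (Fin r))) :
    sahiE (bernoulliWeight (update (SahiCombTopC3.serBase p e σ) none y)) 3 (fun i => ind (subst (parBlock e) (U i))) =
      sahiE (bernoulliWeight (update p e (unitInterval.symm (unitInterval.symm σ * unitInterval.symm y)))) 3
        (fun i => ind (U i)) := by
  rw [sahiE_subst _ (parBlock e) (SahiCombTopC3.serSupp e) (SahiCombTopC3.serSupp_pairwiseDisjoint e) (determinedBy_parBlock e) 3 U,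
    blockParam_parBase]

/-- **The schema inequality at every interior parameter**: if `2Φ(0) + Φ′(0) ≥ 0` for all triples of increasing events on all
finite cubes with a second point, then along every coordinate `e` of every triple of increasing events on `Fin r`,
`2Φ(x) + (1−x)Φ′(x) ≥ 0` for every `x ∈ [0,1]` (parallel substitution + `fourPoint_reparam`). [this work] -/
theorem logDeriv_nonneg_of_end
    (hEnd : ∀ (κ : Type) [Fintype κ] (q : κ → unitInterval) (V : Fin 3 → Set (Set κ)), (∀ i, IsUpperSet (V i)) →
      ∀ (a b : κ), a ≠ b → 0 ≤ 2 * cubicE3 q a (ind (V 0)) (ind (V 1)) (ind (V 2)) 0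
        + derivE3AtZero q a (ind (V 0)) (ind (V 1)) (ind (V 2)))
    (p : Fin r → unitInterval) (e : Fin r) (U : Fin 3 → Set (Set (Fin r))) (hU : ∀ i, IsUpperSet (U i))
    {x : ℝ} (hx0 : 0 ≤ x) (hx1 : x ≤ 1) :
    0 ≤ 2 * cubicE3 p e (ind (U 0)) (ind (U 1)) (ind (U 2)) x
      + (1 - x) * deriv (cubicE3 p e (ind (U 0)) (ind (U 1)) (ind (U 2))) x := by
  set σ : unitInterval := ⟨x, hx0, hx1⟩ with hσ
  set p' : Option (Fin r) → unitInterval := SahiCombTopC3.serBase p e σ with hp'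
  set U' : Fin 3 → Set (Set (Option (Fin r))) := fun i => subst (parBlock e) (U i) with hU'def
  have hU' : ∀ i, IsUpperSet (U' i) := fun i => isUpperSet_subst (fun j => isUpperSet_parBlock e j) (hU i)
  have hbig := hEnd (Option (Fin r)) p' U' hU' none (some e) (Option.some_ne_none e).symm
  rw [logDerivEnd_eq_fourPoint] at hbig
  -- the big fibre cubic at `y` is the small one at `x + (1 − x) y`
  have hval : ∀ (y : ℝ) (hy0 : 0 ≤ y) (hy1 : y ≤ 1),
      cubicE3 p' none (ind (U' 0)) (ind (U' 1)) (ind (U' 2)) y =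
        cubicE3 p e (ind (U 0)) (ind (U 1)) (ind (U 2)) (x + (1 - x) * y) := by
    intro y hy0 hy1
    have h1 := sahiE_three_ind_update_eq p' none ⟨y, hy0, hy1⟩ U'
    have hp'0 : update p' none (⟨y, hy0, hy1⟩ : unitInterval) = update (SahiCombTopC3.serBase p e σ) none ⟨y, hy0, hy1⟩ := rfl
    rw [hp'0, hU'def, sahiE_parSubst, sahiE_three_ind_update_eq] at h1
    have hcoe : ((unitInterval.symm (unitInterval.symm σ * unitInterval.symm (⟨y, hy0, hy1⟩ : unitInterval)) : unitInterval) : ℝ) =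
        x + (1 - x) * y := by
      rw [unitInterval.coe_symm_eq, Set.Icc.coe_mul, unitInterval.coe_symm_eq, unitInterval.coe_symm_eq]
      simp only [hσ]
      ring
    have hcoe' : ((⟨y, hy0, hy1⟩ : unitInterval) : ℝ) = y := rfl
    rw [hcoe, hcoe'] at h1
    exact h1.symm
  rw [hval 0 le_rfl zero_le_one, hval (1 / 3) (by norm_num) (by norm_num), hval (2 / 3) (by norm_num) (by norm_num),
    hval 1 zero_le_one le_rfl] at hbig
  have e0 : x + (1 - x) * 0 = x := by ring
  rw [e0, fourPoint_reparam] at hbig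
  exact hbig

/-- **The induction on a determining set** (cube `Fin r`): under the endpoint hypothesis, every triple of increasing events determined
by `S` has `E_3(μ_p) ≥ 0` for every product measure `p`.  Step at `e`: `Φ(0) = E_3` of the `0`-sections (`≥ 0`, induction),
`2Φ + (1−x)Φ′ ≥ 0` on `[0,1)` (`logDeriv_nonneg_of_end`), so `Φ ≥ 0` on `[0,1]` (`LogDerivSchema.nonneg_of_logDeriv_nonneg`). [this work] -/
theorem sahiE_three_nonneg_of_determinedBy
    (hEnd : ∀ (κ : Type) [Fintype κ] (q : κ → unitInterval) (V : Fin 3 → Set (Set κ)), (∀ i, IsUpperSet (V i)) →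
      ∀ (a b : κ), a ≠ b → 0 ≤ 2 * cubicE3 q a (ind (V 0)) (ind (V 1)) (ind (V 2)) 0
        + derivE3AtZero q a (ind (V 0)) (ind (V 1)) (ind (V 2)))
    (S : Finset (Fin r)) :
    ∀ (U : Fin 3 → Set (Set (Fin r))), (∀ i, IsUpperSet (U i)) → (∀ i, DeterminedBy (U i) (↑S : Set (Fin r))) →
      ∀ p : Fin r → unitInterval, 0 ≤ sahiE (bernoulliWeight p) 3 (fun i => ind (U i)) := by
  induction S using Finset.induction_on with
  | empty =>
    intro U _ hUd p
    rw [sahiE_bernoulliWeight_eq_sum_combCoeff]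
    exact sum_nonneg fun j _ => mul_nonneg
      (combCoeff_ind_nonneg_of_trivial U (fun i => eq_empty_or_univ_of_determinedBy_empty (hUd i)) j) (bern_nonneg _ _ _)
  | insert e S heS ih =>
    intro U hU hUd p
    have hsec : ∀ i : Fin 3, DeterminedBy (secAt e false (U i)) (↑S : Set (Fin r)) := fun i => by
      simpa only [erase_insert heS] using determinedBy_secAt e false (hUd i)
    -- `Φ(0) ≥ 0`
    have h0 : 0 ≤ cubicE3 p e (ind (U 0)) (ind (U 1)) (ind (U 2)) 0 := by
      rw [cubicE3_zero_eq_secAt]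
      exact ih _ (fun i => isUpperSet_secAt e false (hU i)) hsec p
    have hM : ∀ x ∈ Set.Ico (0 : ℝ) 1, 0 ≤ 2 * cubicE3 p e (ind (U 0)) (ind (U 1)) (ind (U 2)) x
        + (1 - x) * deriv (cubicE3 p e (ind (U 0)) (ind (U 1)) (ind (U 2))) x :=
      fun x hx => logDeriv_nonneg_of_end hEnd p e U hU hx.1 hx.2.le
    have hmain := LogDerivSchema.nonneg_of_logDeriv_nonneg (differentiable_cubicE3 p e _ _ _) h0 hM (p e) ⟨(p e).2.1, (p e).2.2⟩
    have hE := sahiE_three_ind_update_eq p e (p e) U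
    rw [update_eq_self] at hE
    rw [hE]
    exact hmain

end Parallel

/-- **THE ENDPOINT INEQUALITY `2Φ(0) + Φ′(0) ≥ 0` IMPLIES SAHI'S `C_3` ON PRODUCT MEASURES.**  If along every axis `a` (with a second
point `b ≠ a`) of every triple of increasing events on every finite cube the fibre cubic `Φ(x) = E_3(μ_{q[a↦x]})` satisfies
`2Φ(0) + Φ′(0) ≥ 0`, then `MasterFamilyNonneg 3`. [this work] -/
theorem masterFamilyNonneg_three_of_logDerivEnd_nonneg
    (hEnd : ∀ (κ : Type) [Fintype κ] (q : κ → unitInterval) (V : Fin 3 → Set (Set κ)), (∀ i, IsUpperSet (V i)) →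
      ∀ (a b : κ), a ≠ b → 0 ≤ 2 * cubicE3 q a (ind (V 0)) (ind (V 1)) (ind (V 2)) 0
        + derivE3AtZero q a (ind (V 0)) (ind (V 1)) (ind (V 2))) :
    MasterFamilyNonneg 3 := by
  intro ι _ p U hU
  obtain ⟨φ⟩ : Nonempty (ι ≃ Fin (Fintype.card ι)) := ⟨Fintype.equivFin ι⟩
  have hU' : ∀ j, IsUpperSet (ThreePartition.comapFam φ.symm (U j)) :=
    fun j => SahiC4CombBridge.isUpperSet_comapFam φ (hU j)
  rw [← SahiC4CombBridge.sahiE_bernoulliWeight_comap_equiv φ p 3 U]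
  exact sahiE_three_nonneg_of_determinedBy hEnd Finset.univ _ hU' (fun j => determinedBy_coe_univ _) _

/-! ### The line sums: the bottom comb law gives the endpoint inequality -/

section Bottom

variable {κ : Type} [Fintype κ]

/-- **`B_1 − B_0 = 2Φ(0) + Φ′(0)`**: the two lowest line sums of the comb expansion along `a` (`SahiCombTopC3.lineSum`) control the
endpoint quantity of the schema. [this work] -/
theorem lineSum_one_sub_zero_eq (V : Fin 3 → Set (Set κ)) (a : κ) (q : κ → unitInterval) :
    SahiCombTopC3.lineSum V a q 1 - SahiCombTopC3.lineSum V a q 0 =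
      2 * cubicE3 q a (ind (V 0)) (ind (V 1)) (ind (V 2)) 0 + derivE3AtZero q a (ind (V 0)) (ind (V 1)) (ind (V 2)) := by
  have hval : ∀ (y : ℝ) (hy0 : 0 ≤ y) (hy1 : y ≤ 1),
      cubicE3 q a (ind (V 0)) (ind (V 1)) (ind (V 2)) y =
        SahiCombTopC3.lineSum V a q 0 * (1 - y) ^ 3 + SahiCombTopC3.lineSum V a q 1 * (y * (1 - y) ^ 2)
          + SahiCombTopC3.lineSum V a q 2 * (y ^ 2 * (1 - y)) + SahiCombTopC3.lineSum V a q 3 * y ^ 3 := by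
    intro y hy0 hy1
    have h3 := SahiCombTopC3.sahiE_three_eq_lineSum V a (update q a ⟨y, hy0, hy1⟩)
    rw [SahiCombTopC3.lineSum_update_param, SahiCombTopC3.lineSum_update_param, SahiCombTopC3.lineSum_update_param,
      SahiCombTopC3.lineSum_update_param, update_self, sahiE_three_ind_update_eq] at h3
    exact h3
  have e0 := hval 0 le_rfl zero_le_one
  have e13 := hval (1 / 3) (by norm_num) (by norm_num)
  have e23 := hval (2 / 3) (by norm_num) (by norm_num)
  have e1 := hval 1 zero_le_one le_rfl
  rw [logDerivEnd_eq_fourPoint, e0, e13, e23, e1]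
  ring

/-- **BOTTOM ORDER-1(3) on the lines along `a` supplies the endpoint inequality.** [this work] -/
theorem logDerivEnd_nonneg_of_combLine_bottom_le (V : Fin 3 → Set (Set κ)) (a : κ) (q : κ → unitInterval)
    (hV : ∀ k : κ → ℕ, combLine 3 V a k 0 ≤ combLine 3 V a k 1) :
    0 ≤ 2 * cubicE3 q a (ind (V 0)) (ind (V 1)) (ind (V 2)) 0 + derivE3AtZero q a (ind (V 0)) (ind (V 1)) (ind (V 2)) := by
  rw [← lineSum_one_sub_zero_eq]
  exact sub_nonneg.2 (sum_le_sum fun k _ => mul_le_mul_of_nonneg_right (hV k) (SahiCombTopC3.offWeight_nonneg a q k))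

end Bottom

end SahiLogDerivEnd

open SahiLogDerivEnd

/-- **THE BOTTOM HALF OF COMB ORDER-1(3) ALONE IMPLIES SAHI'S `C_3` ON PRODUCT MEASURES.**  If `c_0 ≤ c_1` on every coefficient line of
the three-copy comb array of every triple of increasing events on every finite cube with a second point `b ≠ a` (the bottom half of
INEQ-CLAIMS row COMB-M-E3; `m ≤ 5` exhaustive), then `MasterFamilyNonneg 3`.  Companion of gen 7's
`masterFamilyNonneg_three_of_combLine_top_le` (top half); either half suffices. [this work] -/
theorem masterFamilyNonneg_three_of_combLine_bottom_le
    (hBot : ∀ (κ : Type) [Fintype κ] (V : Fin 3 → Set (Set κ)), (∀ i, IsUpperSet (V i)) →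
      ∀ (a b : κ), a ≠ b → ∀ k : κ → ℕ, combLine 3 V a k 0 ≤ combLine 3 V a k 1) :
    MasterFamilyNonneg 3 :=
  masterFamilyNonneg_three_of_logDerivEnd_nonneg fun κ _ q V hV a b hab =>
    logDerivEnd_nonneg_of_combLine_bottom_le V a q (hBot κ V hV a b hab)

/-- **Bottom ORDER-1(3) ⟹ Kahn's Conjecture 5.** [this work] -/
theorem kahnConjecture_of_combLine_bottom_le
    (hBot : ∀ (κ : Type) [Fintype κ] (V : Fin 3 → Set (Set κ)), (∀ i, IsUpperSet (V i)) →
      ∀ (a b : κ), a ≠ b → ∀ k : κ → ℕ, combLine 3 V a k 0 ≤ combLine 3 V a k 1) :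
    KahnConjecture :=
  masterFamilyNonneg_three_iff_kahnConjecture.1 (masterFamilyNonneg_three_of_combLine_bottom_le hBot)


end Summit.CriticalPhenomena.PercolationContinuityZ3.Theorems
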